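import Summits.QuantumFields.BalabanUV.Beta.FP.PerfectSymbolKMultiplierClosed
import Summits.QuantumFields.BalabanUV.Beta.FP.PerfectMaxwellSymbol

/-!
# `BalabanUV.Beta.FP.PerfectMaxwellDict` — road «FP» for binder row D1, leaf H2-P, sub-row H2-P-DICT (owner ruling R-FP-15;
# `HOME/b2b-balaban-beta-d1-p3/H2-DESIGN.md` §5): THE DICTIONARY between Bałaban's perfect effective Laplacian `Δ_∞`
# (`EffectiveLaplacianLimit.deltaZLim`, a kernel on the bonds of `ℤ^{d+1}`) and the WEIGHTED MAXWELL FORM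
# (`PerfectMaxwellSymbol.maxwellQ`) of the continuum (1.66) weights `Re W_∞` — Δ_∞ IS the lattice kernel of a bond-basis symbol
# matrix, and the quadratic form of that matrix at a real momentum IS `maxwellQ (Re W_∞(·,·;p)) (a ↦ e^{ip_a} − 1)`

HONEST DEPENDENCY (page 1, mandatory): continuum YM on T⁴ ⇐ BetaPertH ∧ nine spine estimates (0/9 proved); BetaPertH ⇐ (D1) ∧ (D4) ∧ CAP+tail;
G-an2-4 gates asym, D1 and NE2/3/4.  HONEST FRAMING (cell contract, verbatim): «discharging `BetaPertH` makes Bałaban's UV stability UNCONDITIONAL —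
a real constructive-QFT result; it is NOT the continuum limit and NOT the Clay problem.»  THIS MODULE DISCHARGES NOTHING of the wall: it is the
momentum-space READING of OUR perfect object `Δ_∞` ([our object] bookkeeping: finite sums over `Fin (d+1)`, linearity of the lattice Fourier
integral, one dominated-convergence measurability step), feeding road FP's analytic leaf H2-P («`P_{j+1} := (deltaZ-form + covariant coarse slice)⁻¹`
as a lattice kernel = symbol inverse»).  ONE data def (`bondSymbol`, the bond-basis symbol matrix of an entry-symbol family — [our object]); no
`def … : Prop`; nothing cited as a hypothesis; 0 sorry; 0 wall binders; NOT D1, NOT BetaPertH, NOT continuum, NOT Clay.  «not in print; our bookkeeping».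

ABSOLUTE RULE (cell charter, verbatim): «No internally-minted statement may enter as a cited fact. Every hypothesis is either kernel-proved in this package or a
verbatim quotation of a PUBLISHED theorem with page reference. The manuscript(s) under audit are NOT citable for their own disputed steps — they are the thing
under adjudication; programme-internal (2001/route/tribunal) claims are never citable.»

WHAT.  For an ENTRY-SYMBOL FAMILY `Gf μ ν a b : (Fin (d+1) → ℂ) → ℂ` (on the road: the continued (1.66) entry symbols `B5Symbol166Strip.Gsym n μ ν a b` at
level `n`, and their CLOSED-FORM limit `PerfectSymbolKMultiplierClosed.GsymInf μ ν a b = ½·W_∞(μ,ν;p)·(e^{−ip_a} − 1)(e^{ip_b} − 1)`):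
* §1 `bondSymbol Gf α β p := Σ_{μ ≠ ν} [ι_{να}ι_{νβ}·Gf_{μν;μμ}(p) − ι_{να}ι_{μβ}·Gf_{μν;μν}(p) − ι_{μα}ι_{νβ}·Gf_{μν;νμ}(p) + ι_{μα}ι_{μβ}·Gf_{μν;νν}(p)]` — the
  combination `DirichletExhaustionDeltaZ.summand` of the BOND-BASIS dictionary, read on the symbols instead of the kernels.
* §2 KERNEL DICTIONARY: `re_latticeKernel_bondSymbol` — `Re latticeKernel (bondSymbol Gf α β) z = Σ_{μ≠ν} summand (Re latticeKernel Gf_{μν;··}) μ ν α β z`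
  under integrability of the entry integrands on the zone; instances **`deltaZLim_eq_re_latticeKernel`** (`Δ_∞((x,α),(y,β)) = Re latticeKernel
  (bondSymbol GsymInf α β) (x − y)`; the `GsymInf` integrands are integrable as bounded a.e.-limits of the strip-regular `Gsym (j+1)` integrands) and
  **`deltaZ_eq_re_latticeKernel`** (`Δ_k = deltaZ L k` likewise with `Gsym (L^k)`).
* §3 FORM DICTIONARY: `quadForm_bondSymbol_eq_maxwellQ` — if `Gf_{μν;ab}(p) = ½·W μ ν·conj(ph a)·ph b` (`μ ≠ ν`) then
  `Σ_{α,β} conj(v α)·bondSymbol Gf α β p·v β = ↑(maxwellQ W ph v)`; Hermitian symmetry `bondSymbol_swap`; instances at every REAL momentum `s ∈ [−π,π]^{d+1}`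
  with `ph := d1Sym s = (a ↦ e^{i s_a} − 1)`: **`quadForm_bondSymbol_GsymInf`** (weights `Re W_∞(·,·; s)`; `W166Inf_ofReal_im` off the origin, `W166Inf_zero`
  at it) — THE ROW's LITERAL «⟪v, (symbol of Δ_∞ at real p) v⟫ = maxwellQ (Re W_∞(·;p)) (a ↦ e^{ip_a} − 1) v» — and `quadForm_bondSymbol_Gsym` (level `n ≥ 1`,
  the printed weights `w166 n`); consequences read off p229918 (`…_nonneg` ∕ `_pureGauge` ∕ `_bounds`): a NONNEGATIVE Hermitian form, lattice pure gauges
  `c • d1Sym s` in its kernel, two-sided comparison `(4/π²)^{d+2}·maxwellQ 1 ≤ · ≤ (π²/4)^{2d+4}·maxwellQ 1` with plain Maxwell.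
* NOT HERE (sibling module `PerfectMaxwellDictPlancherel`): the Plancherel form `Σ_{x,y∈S} Σ_{α,β} B x α·Δ_∞((x,α),(y,β))·B y β =
  (2π)^{−(d+1)}∫_{BZ} maxwellQ (Re W_∞(·,·;s)) (d1Sym s) (B̂ s) ds` for real finitely supported bond fields ((1.66)'s third expression at `k = ∞`).
Provenance: G-an2-4 swarm leaf prover 02, gen 34 (prover-b2b-balaban-gan24-formalise-leaf-02-g34-0), cross-lane on road FP's row H2-P-DICT, 2026-08-20.
-/

noncomputable section

namespace Summit.QuantumFields.BalabanUV.Beta.FP.PerfectMaxwellDict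

open MeasureTheory Filter Topology Finset Complex
open scoped BigOperators ComplexConjugate
open Literature.MathematicalPhysics.QuantumFieldTheory.Balaban1983to89
open B4Strip (Strip ofRealVec)
open B4ContourShift (BZ phase integrand fourierBox latticeKernel ofRealVec_mem_Strip norm_cexp_phase phase_eq_ofReal)
open B5Prop11Fiber (d1Sym)
open B5Bounds167Lattice (w166)
open B5Symbol166Strip (Gsym expFacNeg expFacPos MG kappa166 kappa166_pos stripRegular_Gsym Gsym_ofReal Gsym_ofReal_zero
  expFacNeg_ofReal expFacPos_ofReal)
open B4Sect5Exhaustion (K)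
open Summit.QuantumFields.BalabanUV.Beta.GAN24.DirichletExhaustionDeltaZ (summand dirI deltaZ)
open Summit.QuantumFields.BalabanUV.Beta.GAN24.EffectiveLaplacianLimit (GsymLim deltaZLim tendsto_Gsym norm_GsymLim_le volume_BZ_ne_top
  measurableSet_BZ)
open Summit.QuantumFields.BalabanUV.Beta.FP.PerfectSymbol166 (W166Inf W166Inf_zero)
open Summit.QuantumFields.BalabanUV.Beta.FP.PerfectSymbol166Pos (W166Inf_ofReal_eq_re W166Inf_ofReal_re_pos)
open Summit.QuantumFields.BalabanUV.Beta.FP.PerfectSymbolKMultiplierClosed (GsymInf GsymLim_eq_GsymInf deltaZLim_eq_closed)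
open Summit.QuantumFields.BalabanUV.Beta.FP.PerfectMaxwellSymbol (maxwellQ maxwellQ_nonneg maxwellQ_pureGauge maxwellQ_W166Inf_lower
  maxwellQ_W166Inf_upper)

variable {d : ℕ}

/-! ## §1 The bond-basis symbol matrix of an entry-symbol family -/

/-- [our object] **THE BOND-BASIS SYMBOL MATRIX** of an entry-symbol family `Gf μ ν a b` (directions `α, β` of the two bonds):
`Σ_{μ ≠ ν} [ι_{να}ι_{νβ}·Gf_{μν;μμ} − ι_{να}ι_{μβ}·Gf_{μν;μν} − ι_{μα}ι_{νβ}·Gf_{μν;νμ} + ι_{μα}ι_{μβ}·Gf_{μν;νν}]` — `DirichletExhaustionDeltaZ.summand`'s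
combination on symbols. -/
def bondSymbol (Gf : Fin (d + 1) → Fin (d + 1) → Fin (d + 1) → Fin (d + 1) → (Fin (d + 1) → ℂ) → ℂ) (α β : Fin (d + 1))
    (p : Fin (d + 1) → ℂ) : ℂ :=
  ∑ μ : Fin (d + 1), ∑ ν : Fin (d + 1), if μ = ν then 0 else
    (((dirI ν α * dirI ν β : ℝ) : ℂ) * Gf μ ν μ μ p - ((dirI ν α * dirI μ β : ℝ) : ℂ) * Gf μ ν μ ν p
      - ((dirI μ α * dirI ν β : ℝ) : ℂ) * Gf μ ν ν μ p + ((dirI μ α * dirI μ β : ℝ) : ℂ) * Gf μ ν ν ν p)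

/-- [folklore] `Σ_α ι_{κα}·f α = f κ`. -/
theorem sum_dirI_mul (κ : Fin (d + 1)) (f : Fin (d + 1) → ℂ) : ∑ α, ((dirI κ α : ℝ) : ℂ) * f α = f κ := by
  have h : ∀ α, ((dirI κ α : ℝ) : ℂ) * f α = if κ = α then f α else 0 := fun α => by unfold dirI; split_ifs <;> simp
  simp_rw [h]; rw [Finset.sum_ite_eq]; simp

/-- [folklore] `Σ_α f α·ι_{κα} = f κ`. -/
theorem sum_mul_dirI (κ : Fin (d + 1)) (f : Fin (d + 1) → ℂ) : ∑ α, f α * ((dirI κ α : ℝ) : ℂ) = f κ := by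
  simp_rw [mul_comm (f _)]; exact sum_dirI_mul κ f

/-! ## §2 The kernel dictionary: `Δ_∞` (and every `Δ_k`) is the lattice kernel of its bond-basis symbol matrix -/

/-- [folklore] The lattice-kernel integrand is additive in the multiplier. -/
theorem integrand_add (G₁ G₂ : (Fin (d + 1) → ℂ) → ℂ) (x : Fin (d + 1) → ℤ) :
    integrand (fun p => G₁ p + G₂ p) x = fun p => integrand G₁ x p + integrand G₂ x p := by
  funext p; simp only [integrand]; ring

/-- [folklore] … subtractive. -/
theorem integrand_sub (G₁ G₂ : (Fin (d + 1) → ℂ) → ℂ) (x : Fin (d + 1) → ℤ) :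
    integrand (fun p => G₁ p - G₂ p) x = fun p => integrand G₁ x p - integrand G₂ x p := by
  funext p; simp only [integrand]; ring

/-- [folklore] … and homogeneous. -/
theorem integrand_const_mul (c : ℂ) (G : (Fin (d + 1) → ℂ) → ℂ) (x : Fin (d + 1) → ℤ) :
    integrand (fun p => c * G p) x = fun p => c * integrand G x p := by
  funext p; simp only [integrand]; ring

/-- [folklore] The integrand of a finite sum of multipliers. -/
theorem integrand_finset_sum {ι : Type*} (s : Finset ι) (G : ι → (Fin (d + 1) → ℂ) → ℂ) (x : Fin (d + 1) → ℤ) :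
    integrand (fun p => ∑ i ∈ s, G i p) x = fun p => ∑ i ∈ s, integrand (G i) x p := by
  funext p; simp only [integrand, Finset.sum_mul]

/-- [folklore] LINEARITY OF THE LATTICE KERNEL: additivity under integrability on the Brillouin zone. -/
theorem latticeKernel_add {G₁ G₂ : (Fin (d + 1) → ℂ) → ℂ} {x : Fin (d + 1) → ℤ} (h₁ : IntegrableOn (integrand G₁ x) (BZ (d + 1)))
    (h₂ : IntegrableOn (integrand G₂ x) (BZ (d + 1))) :
    latticeKernel (fun p => G₁ p + G₂ p) x = latticeKernel G₁ x + latticeKernel G₂ x := by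
  unfold latticeKernel fourierBox
  rw [integrand_add, integral_add h₁ h₂, smul_add]

/-- [folklore] … subtractivity. -/
theorem latticeKernel_sub {G₁ G₂ : (Fin (d + 1) → ℂ) → ℂ} {x : Fin (d + 1) → ℤ} (h₁ : IntegrableOn (integrand G₁ x) (BZ (d + 1)))
    (h₂ : IntegrableOn (integrand G₂ x) (BZ (d + 1))) :
    latticeKernel (fun p => G₁ p - G₂ p) x = latticeKernel G₁ x - latticeKernel G₂ x := by
  unfold latticeKernel fourierBox
  rw [integrand_sub, integral_sub h₁ h₂, smul_sub]

/-- [folklore] … homogeneity (no integrability needed). -/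
theorem latticeKernel_const_mul (c : ℂ) (G : (Fin (d + 1) → ℂ) → ℂ) (x : Fin (d + 1) → ℤ) :
    latticeKernel (fun p => c * G p) x = c * latticeKernel G x := by
  unfold latticeKernel fourierBox
  rw [integrand_const_mul, integral_const_mul, mul_smul_comm]

/-- [folklore] … finite sums. -/
theorem latticeKernel_finset_sum {ι : Type*} (s : Finset ι) {G : ι → (Fin (d + 1) → ℂ) → ℂ} {x : Fin (d + 1) → ℤ}
    (h : ∀ i ∈ s, IntegrableOn (integrand (G i) x) (BZ (d + 1))) :
    latticeKernel (fun p => ∑ i ∈ s, G i p) x = ∑ i ∈ s, latticeKernel (G i) x := by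
  unfold latticeKernel fourierBox
  rw [integrand_finset_sum, integral_finsetSum s h, Finset.smul_sum]

/-- [folklore] … and the `if … then 0 else …` switch. -/
theorem latticeKernel_ite_zero (P : Prop) [Decidable P] (G : (Fin (d + 1) → ℂ) → ℂ) (x : Fin (d + 1) → ℤ) :
    latticeKernel (fun p => if P then 0 else G p) x = if P then 0 else latticeKernel G x := by
  by_cases h : P
  · simp only [h, if_true]; unfold latticeKernel fourierBox integrand; simp
  · simp only [h, if_false]

/-- [folklore] Integrability of a scaled integrand. -/
theorem integrableOn_integrand_const_mul (c : ℂ) {G : (Fin (d + 1) → ℂ) → ℂ} {x : Fin (d + 1) → ℤ}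
    (h : IntegrableOn (integrand G x) (BZ (d + 1))) : IntegrableOn (integrand (fun p => c * G p) x) (BZ (d + 1)) := by
  rw [integrand_const_mul]; exact h.const_mul c

/-- [folklore] **INTEGRABILITY OF THE SYMBOL-MATRIX INTEGRAND**: if every entry integrand `Gf_{μν;ab}(p)e^{ip·z}` (`μ ≠ ν`) is integrable on the
Brillouin zone, so is the integrand of each `(μ,ν)` term of `bondSymbol Gf α β`, and hence that of `bondSymbol Gf α β` itself. -/
theorem integrableOn_integrand_bondTerm {Gf : Fin (d + 1) → Fin (d + 1) → Fin (d + 1) → Fin (d + 1) → (Fin (d + 1) → ℂ) → ℂ}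
    {z : Fin (d + 1) → ℤ} (hint : ∀ μ ν, μ ≠ ν → ∀ a b, IntegrableOn (integrand (Gf μ ν a b) z) (BZ (d + 1)))
    (α β μ ν : Fin (d + 1)) :
    IntegrableOn (integrand (fun p => if μ = ν then 0 else
      (((dirI ν α * dirI ν β : ℝ) : ℂ) * Gf μ ν μ μ p - ((dirI ν α * dirI μ β : ℝ) : ℂ) * Gf μ ν μ ν p
        - ((dirI μ α * dirI ν β : ℝ) : ℂ) * Gf μ ν ν μ p + ((dirI μ α * dirI μ β : ℝ) : ℂ) * Gf μ ν ν ν p)) z) (BZ (d + 1)) := by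
  by_cases h : μ = ν
  · simp only [h, if_true]
    have : integrand (d := d + 1) (fun _ => (0 : ℂ)) z = fun _ => 0 := by funext p; simp [integrand]
    rw [this]; exact integrableOn_zero
  · simp only [h, if_false]
    rw [integrand_add, integrand_sub, integrand_sub]
    have hI : ∀ a b (r : ℝ), IntegrableOn (integrand (fun p => (r : ℂ) * Gf μ ν a b p) z) (BZ (d + 1)) :=
      fun a b r => integrableOn_integrand_const_mul (r : ℂ) (hint μ ν h a b)
    exact (((hI μ μ _).sub (hI μ ν _)).sub (hI ν μ _)).add (hI ν ν _)

/-- [folklore] … the integrand of the whole symbol matrix entry `bondSymbol Gf α β` is integrable on the zone. -/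
theorem integrableOn_integrand_bondSymbol {Gf : Fin (d + 1) → Fin (d + 1) → Fin (d + 1) → Fin (d + 1) → (Fin (d + 1) → ℂ) → ℂ}
    {z : Fin (d + 1) → ℤ} (hint : ∀ μ ν, μ ≠ ν → ∀ a b, IntegrableOn (integrand (Gf μ ν a b) z) (BZ (d + 1)))
    (α β : Fin (d + 1)) : IntegrableOn (integrand (bondSymbol Gf α β) z) (BZ (d + 1)) := by
  unfold bondSymbol
  rw [integrand_finset_sum]
  refine integrable_finsetSum _ fun μ _ => ?_
  rw [integrand_finset_sum]
  exact integrable_finsetSum _ fun ν _ => integrableOn_integrand_bondTerm hint α β μ ν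

/-- [our object] **THE KERNEL DICTIONARY FOR AN ENTRY-SYMBOL FAMILY**: if every entry integrand `Gf_{μν;ab}(p)e^{ip·z}` (`μ ≠ ν`) is integrable on the
Brillouin zone, the real part of the lattice kernel of the bond-basis symbol matrix is the bond-basis combination (`summand`) of the real parts of the entry
kernels. -/
theorem re_latticeKernel_bondSymbol {Gf : Fin (d + 1) → Fin (d + 1) → Fin (d + 1) → Fin (d + 1) → (Fin (d + 1) → ℂ) → ℂ}
    {z : Fin (d + 1) → ℤ} (hint : ∀ μ ν, μ ≠ ν → ∀ a b, IntegrableOn (integrand (Gf μ ν a b) z) (BZ (d + 1))) (α β : Fin (d + 1)) :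
    (latticeKernel (bondSymbol Gf α β) z).re =
      ∑ μ : Fin (d + 1), ∑ ν : Fin (d + 1),
        if μ = ν then 0 else summand (fun a b x => (latticeKernel (Gf μ ν a b) x).re) μ ν α β z := by
  have hI : ∀ μ ν, μ ≠ ν → ∀ a b (r : ℝ), IntegrableOn (integrand (fun p => (r : ℂ) * Gf μ ν a b p) z) (BZ (d + 1)) :=
    fun μ ν h a b r => integrableOn_integrand_const_mul (r : ℂ) (hint μ ν h a b)
  unfold bondSymbol
  rw [latticeKernel_finset_sum _ (fun μ _ => ?_)]
  swap
  · rw [integrand_finset_sum]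
    exact integrable_finsetSum _ fun ν _ => integrableOn_integrand_bondTerm hint α β μ ν
  rw [re_sum]
  refine Finset.sum_congr rfl fun μ _ => ?_
  rw [latticeKernel_finset_sum _ (fun ν _ => integrableOn_integrand_bondTerm hint α β μ ν), re_sum]
  refine Finset.sum_congr rfl fun ν _ => ?_
  rw [latticeKernel_ite_zero]
  split_ifs with h
  · simp
  · rw [latticeKernel_add ?_ (hI μ ν h ν ν _), latticeKernel_sub ?_ (hI μ ν h ν μ _), latticeKernel_sub (hI μ ν h μ μ _) (hI μ ν h μ ν _)]
    rotate_left
    · rw [integrand_sub]; exact (hI μ ν h μ μ _).sub (hI μ ν h μ ν _)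
    · rw [integrand_sub, integrand_sub]; exact ((hI μ ν h μ μ _).sub (hI μ ν h μ ν _)).sub (hI μ ν h ν μ _)
    simp only [add_re, sub_re, latticeKernel_const_mul, re_ofReal_mul, summand]

/-- [our object] **INTEGRABILITY OF THE PERFECT ENTRY INTEGRANDS**: for `μ ≠ ν` the integrand `G^{ab}_{μν,∞}(p)e^{ip·z}` of the closed-form entry symbol is
integrable on `[−π,π]^{d+1}` — it is the a.e. (indeed pointwise) limit of the strip-regular, hence integrable, level-`(j+1)` integrands
(`stripRegular_Gsym`, `tendsto_Gsym`, `GsymLim_eq_GsymInf` at width `0`) and is bounded by `MG(d+1)` (`norm_GsymLim_le`). -/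
theorem integrableOn_integrand_GsymInf {μ ν : Fin (d + 1)} (hμν : μ ≠ ν) (a b : Fin (d + 1)) (z : Fin (d + 1) → ℤ) :
    IntegrableOn (integrand (GsymInf μ ν a b) z) (BZ (d + 1)) := by
  have hκ : (0 : ℝ) ≤ kappa166 (d + 1) := (kappa166_pos _).le
  have hmeas : AEStronglyMeasurable (integrand (GsymInf μ ν a b) z) (volume.restrict (BZ (d + 1))) := by
    refine aestronglyMeasurable_of_tendsto_ae atTop (f := fun j : ℕ => integrand (fun p => Gsym (j + 1) μ ν a b p) z) ?_ ?_
    · intro j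
      exact ((stripRegular_Gsym (d := d) (j + 1) hκ le_rfl hμν a b).integrableOn hκ z).aestronglyMeasurable
    · refine ae_restrict_of_forall_mem (measurableSet_BZ d) fun p hp => ?_
      unfold integrand
      have ht := (tendsto_Gsym le_rfl hκ (ofRealVec_mem_Strip le_rfl hp) μ ν a b).mul_const (cexp (I * phase p z))
      rwa [GsymLim_eq_GsymInf le_rfl hκ (ofRealVec_mem_Strip le_rfl hp)] at ht
  refine IntegrableOn.of_bound (volume_BZ_ne_top d).lt_top hmeas (MG (d + 1)) ?_
  refine ae_restrict_of_forall_mem (measurableSet_BZ d) fun p hp => ?_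
  unfold integrand
  rw [norm_mul, norm_cexp_phase, mul_one, ← GsymLim_eq_GsymInf le_rfl hκ (ofRealVec_mem_Strip le_rfl hp)]
  exact norm_GsymLim_le le_rfl hκ (ofRealVec_mem_Strip le_rfl hp) μ ν a b

/-- [our object] **Δ_∞ IS THE LATTICE KERNEL OF ITS BOND-BASIS SYMBOL MATRIX**: for all bonds `b = (x,α)`, `b′ = (y,β)` of `ℤ^{d+1}`,
`deltaZLim b b′ = Re latticeKernel (bondSymbol GsymInf α β) (x − y)` (`deltaZLim_eq_closed` + §2's linearity). -/
theorem deltaZLim_eq_re_latticeKernel (b b' : K (d + 1) (d + 1)) :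
    deltaZLim (d := d) b b' = (latticeKernel (bondSymbol GsymInf b.2 b'.2) (b.1 - b'.1)).re := by
  rw [deltaZLim_eq_closed, re_latticeKernel_bondSymbol (fun μ ν h a c => integrableOn_integrand_GsymInf h a c _)]

/-- [our object] The same dictionary AT EVERY FINITE LEVEL: `deltaZ L k b b′ = Re latticeKernel (bondSymbol (Gsym (L^k)) α β) (x − y)` — Bałaban's `Δ_k`
((1.66), typed on `ℤ^{d+1}` as `DirichletExhaustionDeltaZ.deltaZ`) is the lattice kernel of the bond-basis symbol matrix of the level-`L^k` entry symbols
(integrability from `stripRegular_Gsym`). -/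
theorem deltaZ_eq_re_latticeKernel (L : ℕ) [NeZero L] (k : ℕ) (b b' : K (d + 1) (d + 1)) :
    deltaZ (d := d) L k b b' = (latticeKernel (bondSymbol (fun μ ν a c p => Gsym (L ^ k) μ ν a c p) b.2 b'.2) (b.1 - b'.1)).re := by
  have hκ : (0 : ℝ) ≤ kappa166 (d + 1) := (kappa166_pos _).le
  rw [re_latticeKernel_bondSymbol (fun μ ν h a c => (stripRegular_Gsym (d := d) (L ^ k) hκ le_rfl h a c).integrableOn hκ _)]
  rfl

/-! ## §3 The form dictionary: the quadratic form of the symbol matrix is the weighted Maxwell form -/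

/-- [folklore] `(↑‖z‖)² = conj z · z`. -/
theorem ofReal_norm_sq_eq_conj_mul (z : ℂ) : ((‖z‖ : ℝ) : ℂ) ^ 2 = conj z * z := by
  rw [← ofReal_pow, ← normSq_eq_norm_sq, normSq_eq_conj_mul_self]

/-- [our object] **THE FORM DICTIONARY (GENERAL)**: if the entry symbols factor as `Gf_{μν;ab}(p) = ½·W μ ν·conj(ph a)·ph b` (`μ ≠ ν`) for REAL weights `W`
and momentum factors `ph`, then for every amplitude `v : Fin (d+1) → ℂ` the quadratic form of the bond-basis symbol matrix is the weighted Maxwell form: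
`Σ_{α,β} conj(v α)·bondSymbol Gf α β p·v β = ↑(maxwellQ W ph v)`. -/
theorem quadForm_bondSymbol_eq_maxwellQ {Gf : Fin (d + 1) → Fin (d + 1) → Fin (d + 1) → Fin (d + 1) → (Fin (d + 1) → ℂ) → ℂ}
    {W : Fin (d + 1) → Fin (d + 1) → ℝ} {ph : Fin (d + 1) → ℂ} {p : Fin (d + 1) → ℂ}
    (hG : ∀ μ ν, μ ≠ ν → ∀ a b, Gf μ ν a b p = 1 / 2 * (W μ ν : ℂ) * (conj (ph a) * ph b)) (v : Fin (d + 1) → ℂ) :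
    ∑ α, ∑ β, conj (v α) * bondSymbol Gf α β p * v β = ((maxwellQ W ph v : ℝ) : ℂ) := by
  -- exchanging the bond sums `α, β` with the plaquette sums `μ, ν`
  have four_swap : ∀ F : Fin (d + 1) → Fin (d + 1) → Fin (d + 1) → Fin (d + 1) → ℂ,
      ∑ α, ∑ β, ∑ μ, ∑ ν, F α β μ ν = ∑ μ, ∑ ν, ∑ α, ∑ β, F α β μ ν := by
    intro F
    calc ∑ α, ∑ β, ∑ μ, ∑ ν, F α β μ ν = ∑ α, ∑ μ, ∑ β, ∑ ν, F α β μ ν :=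
          Finset.sum_congr rfl fun _ _ => Finset.sum_comm
      _ = ∑ μ, ∑ α, ∑ β, ∑ ν, F α β μ ν := Finset.sum_comm
      _ = ∑ μ, ∑ α, ∑ ν, ∑ β, F α β μ ν :=
          Finset.sum_congr rfl fun _ _ => Finset.sum_congr rfl fun _ _ => Finset.sum_comm
      _ = ∑ μ, ∑ ν, ∑ α, ∑ β, F α β μ ν := Finset.sum_congr rfl fun _ _ => Finset.sum_comm
  have expand : ∀ M : Fin (d + 1) → Fin (d + 1) → Fin (d + 1) → Fin (d + 1) → ℂ,
      ∑ α, ∑ β, conj (v α) * (∑ μ, ∑ ν, M μ ν α β) * v β = ∑ μ, ∑ ν, ∑ α, ∑ β, conj (v α) * M μ ν α β * v β := by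
    intro M
    rw [← four_swap]
    refine Finset.sum_congr rfl fun α _ => Finset.sum_congr rfl fun β _ => ?_
    rw [Finset.mul_sum, Finset.sum_mul]
    refine Finset.sum_congr rfl fun μ _ => ?_
    rw [Finset.mul_sum, Finset.sum_mul]
  -- collapsing the direction indicators against the two amplitudes
  have collapse : ∀ (κ κ' : Fin (d + 1)) (X : ℂ),
      ∑ α, ∑ β, conj (v α) * (((dirI κ α * dirI κ' β : ℝ) : ℂ) * X) * v β = conj (v κ) * X * v κ' := by
    intro κ κ' X
    have e : ∀ α β, conj (v α) * (((dirI κ α * dirI κ' β : ℝ) : ℂ) * X) * v β =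
        (conj (v α) * ((dirI κ α : ℝ) : ℂ)) * (((dirI κ' β : ℝ) : ℂ) * (X * v β)) := by
      intro α β; push_cast; ring
    simp_rw [e, ← Finset.mul_sum, sum_dirI_mul, ← Finset.sum_mul, sum_mul_dirI]
    ring
  -- the plaquette identity, `μ ≠ ν`
  have plaq : ∀ μ ν, μ ≠ ν →
      ∑ α, ∑ β, conj (v α) * (((dirI ν α * dirI ν β : ℝ) : ℂ) * Gf μ ν μ μ p - ((dirI ν α * dirI μ β : ℝ) : ℂ) * Gf μ ν μ ν p
        - ((dirI μ α * dirI ν β : ℝ) : ℂ) * Gf μ ν ν μ p + ((dirI μ α * dirI μ β : ℝ) : ℂ) * Gf μ ν ν ν p) * v β =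
      (((1 / 2) * W μ ν * ‖ph μ * v ν - ph ν * v μ‖ ^ 2 : ℝ) : ℂ) := by
    intro μ ν h
    have split : ∀ α β, conj (v α) * (((dirI ν α * dirI ν β : ℝ) : ℂ) * Gf μ ν μ μ p - ((dirI ν α * dirI μ β : ℝ) : ℂ) * Gf μ ν μ ν p
          - ((dirI μ α * dirI ν β : ℝ) : ℂ) * Gf μ ν ν μ p + ((dirI μ α * dirI μ β : ℝ) : ℂ) * Gf μ ν ν ν p) * v β =
        conj (v α) * (((dirI ν α * dirI ν β : ℝ) : ℂ) * Gf μ ν μ μ p) * v β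
          - conj (v α) * (((dirI ν α * dirI μ β : ℝ) : ℂ) * Gf μ ν μ ν p) * v β
          - conj (v α) * (((dirI μ α * dirI ν β : ℝ) : ℂ) * Gf μ ν ν μ p) * v β
          + conj (v α) * (((dirI μ α * dirI μ β : ℝ) : ℂ) * Gf μ ν ν ν p) * v β := by
      intro α β; ring
    simp_rw [split, Finset.sum_add_distrib, Finset.sum_sub_distrib, collapse, hG μ ν h]
    push_cast
    rw [ofReal_norm_sq_eq_conj_mul, map_sub, map_mul, map_mul]
    ring
  unfold bondSymbol maxwellQ
  rw [expand, ofReal_sum]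
  refine Finset.sum_congr rfl fun μ _ => ?_
  rw [ofReal_sum]
  refine Finset.sum_congr rfl fun ν _ => ?_
  by_cases h : μ = ν
  · simp [h]
  · simp only [h, if_false]
    exact plaq μ ν h

/-- [our object] **HERMITIAN SYMMETRY** of the bond-basis symbol matrix under the same factorisation: `bondSymbol Gf β α p = conj (bondSymbol Gf α β p)`. -/
theorem bondSymbol_swap {Gf : Fin (d + 1) → Fin (d + 1) → Fin (d + 1) → Fin (d + 1) → (Fin (d + 1) → ℂ) → ℂ}
    {W : Fin (d + 1) → Fin (d + 1) → ℝ} {ph : Fin (d + 1) → ℂ} {p : Fin (d + 1) → ℂ}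
    (hG : ∀ μ ν, μ ≠ ν → ∀ a b, Gf μ ν a b p = 1 / 2 * (W μ ν : ℂ) * (conj (ph a) * ph b)) (α β : Fin (d + 1)) :
    bondSymbol Gf β α p = conj (bondSymbol Gf α β p) := by
  unfold bondSymbol
  rw [map_sum]
  refine Finset.sum_congr rfl fun μ _ => ?_
  rw [map_sum]
  refine Finset.sum_congr rfl fun ν _ => ?_
  by_cases h : μ = ν
  · simp [h]
  · simp only [h, if_false, hG μ ν h, map_add, map_sub, map_mul, map_div₀, map_one, map_ofNat, conj_ofReal, conj_conj]
    ring

/-- [our object] `W_∞(μ,ν;s)` IS ITS REAL PART ON THE WHOLE REAL ZONE (`μ ≠ ν`; `W166Inf_zero` at the origin, `W166Inf_ofReal_eq_re` off it). -/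
theorem W166Inf_ofReal_eq_re_of_mem {μ ν : Fin (d + 1)} (hμν : μ ≠ ν) {s : Fin (d + 1) → ℝ} (hs : s ∈ BZ (d + 1)) :
    W166Inf μ ν (ofRealVec s) = (((W166Inf μ ν (ofRealVec s)).re : ℝ) : ℂ) := by
  by_cases h0 : s = 0
  · subst h0
    have hz : ofRealVec (0 : Fin (d + 1) → ℝ) = (0 : Fin (d + 1) → ℂ) := funext fun _ => by simp [ofRealVec]
    rw [hz, W166Inf_zero]; simp
  · obtain ⟨ν₀, hν₀⟩ : ∃ ν₀, s ν₀ ≠ 0 := by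
      by_contra hall
      push Not at hall
      exact h0 (funext hall)
    exact W166Inf_ofReal_eq_re hμν hs ν₀ hν₀

/-- [our object] THE FACTORISATION OF THE PERFECT ENTRY SYMBOLS AT A REAL MOMENTUM: `G^{ab}_{μν,∞}(s) = ½·Re W_∞(μ,ν;s)·conj(∂¹_a(s))·∂¹_b(s)` with
`∂¹_a(s) = e^{i s_a} − 1 = d1Sym s a` (`expFacNeg_ofReal`, `expFacPos_ofReal`, and the reality of `W_∞`). -/
theorem GsymInf_ofReal {μ ν : Fin (d + 1)} (hμν : μ ≠ ν) (a b : Fin (d + 1)) {s : Fin (d + 1) → ℝ} (hs : s ∈ BZ (d + 1)) :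
    GsymInf μ ν a b (ofRealVec s) = 1 / 2 * (((W166Inf μ ν (ofRealVec s)).re : ℝ) : ℂ) * (conj (d1Sym s a) * d1Sym s b) := by
  unfold GsymInf
  rw [expFacNeg_ofReal, expFacPos_ofReal, ← W166Inf_ofReal_eq_re_of_mem hμν hs]

/-- [our object] **THE ROW's LITERAL — «⟪v, (symbol of Δ_∞ at real p) v⟫ = maxwellQ (Re W_∞(·;p)) (a ↦ e^{ip_a} − 1) v»**: at every real momentum
`s ∈ [−π,π]^{d+1}` and for every amplitude `v`,
`Σ_{α,β} conj(v α)·bondSymbol GsymInf α β (ofRealVec s)·v β = ↑(maxwellQ (fun μ ν => Re W_∞(μ,ν;s)) (d1Sym s) v)`. -/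
theorem quadForm_bondSymbol_GsymInf {s : Fin (d + 1) → ℝ} (hs : s ∈ BZ (d + 1)) (v : Fin (d + 1) → ℂ) :
    ∑ α, ∑ β, conj (v α) * bondSymbol GsymInf α β (ofRealVec s) * v β =
      ((maxwellQ (fun μ ν => (W166Inf μ ν (ofRealVec s)).re) (d1Sym s) v : ℝ) : ℂ) :=
  quadForm_bondSymbol_eq_maxwellQ (fun _ _ h a b => GsymInf_ofReal h a b hs) v

/-- [our object] Hermitian symmetry of the symbol matrix of `Δ_∞` on the real zone. -/
theorem bondSymbol_GsymInf_swap {s : Fin (d + 1) → ℝ} (hs : s ∈ BZ (d + 1)) (α β : Fin (d + 1)) :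
    bondSymbol GsymInf β α (ofRealVec s) = conj (bondSymbol GsymInf α β (ofRealVec s)) :=
  bondSymbol_swap (fun _ _ h a b => GsymInf_ofReal h a b hs) α β

/-- [our object] THE SAME AT EVERY FINITE LEVEL `n ≥ 1` with the PRINTED weights `w166 n` (`B5Bounds167Lattice.w166`, the function under the integral in
(1.66)): `Σ_{α,β} conj(v α)·bondSymbol (Gsym n) α β (ofRealVec s)·v β = ↑(maxwellQ (w166 n · · s) (d1Sym s) v)` (`Gsym_ofReal` off the origin; at the origin
both sides vanish). -/
theorem quadForm_bondSymbol_Gsym (n : ℕ) [NeZero n] {s : Fin (d + 1) → ℝ} (hs : s ∈ BZ (d + 1)) (v : Fin (d + 1) → ℂ) :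
    ∑ α, ∑ β, conj (v α) * bondSymbol (fun μ ν a b p => Gsym n μ ν a b p) α β (ofRealVec s) * v β =
      ((maxwellQ (fun μ ν => w166 n μ ν s) (d1Sym s) v : ℝ) : ℂ) := by
  refine quadForm_bondSymbol_eq_maxwellQ (fun μ ν h a b => ?_) v
  by_cases h0 : s = 0
  · subst h0
    have e : Gsym n μ ν a b (ofRealVec (0 : Fin (d + 1) → ℝ)) = 0 := Gsym_ofReal_zero n μ ν a b
    rw [e]; simp [d1Sym]
  · obtain ⟨ν₀, hν₀⟩ : ∃ ν₀, s ν₀ ≠ 0 := by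
      by_contra hall
      push Not at hall
      exact h0 (funext hall)
    exact Gsym_ofReal n h a b s (fun κ => abs_le.mpr ⟨hs.1 κ, hs.2 κ⟩) ν₀ hν₀

/-- [our object] CONSEQUENCE (from p229918): the symbol matrix of `Δ_∞` is a NONNEGATIVE form at every real momentum — its quadratic form is the real
number `maxwellQ (Re W_∞) (d1Sym s) v ≥ 0` (`W166Inf_ofReal_re_pos`, `maxwellQ_nonneg`). -/
theorem quadForm_bondSymbol_GsymInf_nonneg {s : Fin (d + 1) → ℝ} (hs : s ∈ BZ (d + 1)) (v : Fin (d + 1) → ℂ) :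
    0 ≤ (∑ α, ∑ β, conj (v α) * bondSymbol GsymInf α β (ofRealVec s) * v β).re ∧
      (∑ α, ∑ β, conj (v α) * bondSymbol GsymInf α β (ofRealVec s) * v β).im = 0 := by
  rw [quadForm_bondSymbol_GsymInf hs v, ofReal_re, ofReal_im]
  exact ⟨maxwellQ_nonneg (fun μ ν h => (W166Inf_ofReal_re_pos h hs).le) _ v, rfl⟩

/-- [our object] CONSEQUENCE: the LATTICE PURE GAUGES `c • d1Sym s` (Fourier images of lattice gradients) are NULL VECTORS of the symbol matrix of `Δ_∞`
(`maxwellQ_pureGauge`) — gauge invariance of the perfect effective Laplacian in momentum space. -/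
theorem quadForm_bondSymbol_GsymInf_pureGauge {s : Fin (d + 1) → ℝ} (hs : s ∈ BZ (d + 1)) (c : ℂ) :
    ∑ α, ∑ β, conj ((c • d1Sym s) α) * bondSymbol GsymInf α β (ofRealVec s) * (c • d1Sym s) β = 0 := by
  rw [quadForm_bondSymbol_GsymInf hs, maxwellQ_pureGauge, ofReal_zero]

/-- [our object] CONSEQUENCE: the TWO-SIDED COMPARISON WITH PLAIN MAXWELL on the punctured real zone (p229918's `maxwellQ_W166Inf_lower`∕`_upper`):
`(4/π²)^{d+2}·maxwellQ 1 (d1Sym s) v ≤ Re Σ_{α,β} conj(v α)·bondSymbol GsymInf α β (ofRealVec s)·v β ≤ (π²/4)^{2d+4}·maxwellQ 1 (d1Sym s) v` (the lower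
bound on the whole zone) — the coercivity-relative-to-Maxwell input (P-i) of H2-P, now attached to the symbol OF `Δ_∞`. -/
theorem quadForm_bondSymbol_GsymInf_bounds {s : Fin (d + 1) → ℝ} (hs : s ∈ BZ (d + 1)) (v : Fin (d + 1) → ℂ) :
    (4 / Real.pi ^ 2) ^ (d + 1 + 2) * maxwellQ (fun _ _ => (1 : ℝ)) (d1Sym s) v ≤
        (∑ α, ∑ β, conj (v α) * bondSymbol GsymInf α β (ofRealVec s) * v β).re ∧
      (∀ ν₀, s ν₀ ≠ 0 → (∑ α, ∑ β, conj (v α) * bondSymbol GsymInf α β (ofRealVec s) * v β).re ≤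
        (Real.pi ^ 2 / 4) ^ (2 * (d + 1) + 4) * maxwellQ (fun _ _ => (1 : ℝ)) (d1Sym s) v) := by
  rw [quadForm_bondSymbol_GsymInf hs v, ofReal_re]
  exact ⟨maxwellQ_W166Inf_lower hs _ v, fun ν₀ hν₀ => maxwellQ_W166Inf_upper hs ν₀ hν₀ _ v⟩

end Summit.QuantumFields.BalabanUV.Beta.FP.PerfectMaxwellDict

end
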